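import Summits.CriticalPhenomena.Ising3DConformalLimit.Theses.PositivityBegetsConformality
import Summits.CriticalPhenomena.Ising3DConformalLimit.Theses.HyperoctahedralRP
import Summits.CriticalPhenomena.Ising3DConformalLimit.Theorems.PositivityBegetsConformalityInversionPositiveLimitLevelwiseMack
import Summits.CriticalPhenomena.Ising3DConformalLimit.Theorems.PositivityBegetsConformalityInversionPositiveLimitStrata
import Summits.CriticalPhenomena.Ising3DConformalLimit.Theorems.PerfectScreeningMoebiusLimitExistsTwoLeaf
import Summits.CriticalPhenomena.Ising3DConformalLimit.Theorems.HyperoctahedralRPInversionUpgradeNormalisedOSReflectionPositive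
import Summits.CriticalPhenomena.Ising3DConformalLimit.Theorems.HyperoctahedralRPInversionUpgradeNormalisedLatticeRP
import Summits.CriticalPhenomena.Ising3DConformalLimit.Theorems.HyperoctahedralRPInversionUpgradeNormalisedOSLayer
import Summits.CriticalPhenomena.Ising3DConformalLimit.Theorems.MoebiusLimitExists.Negative.MeshContinuity
import Literature.Probability.LatticeModels.InversionPositivity
import Mathlib.Data.Fin.Tuple.Sort
import HarnessLib

/-!
# The four-point cone (item stmt-4672) is EXACTLY the four-point level of the inversion upgrade
(line lead c6 of crux stmt-CriticalPhenomena-4671 `InversionPositiveLimit`; `--supports stmt-CriticalPhenomena-4671`)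

For every admissible limit of the cruxes of route `PositivityBegetsConformality` (normalised, non-degenerate,
translation-invariant, scale-covariant pointwise limit `S` of `criticalCorr 3`), the 2|2 radial OS Gram
matrices of `FourPointConeMembership` (item stmt-4672, the rank-3 crux; `InversionPositiveLimit ⇒ 4672` is the
landed `fourPointConeMembership_of_inversionPositiveLimit`) are positive semidefinite IF AND ONLY IF the
four-point function is inversion covariant, `S₄(ιx) = ∏ᵢ ‖xᵢ‖^{2Δ} S₄(x)` for all `x` avoiding the origin
(`fourPointConeMembership_iff_levelFour`, registered anchor):

* `⇐` (`fourPointConeMembership_of_levelFour`): the LEVELWISE Mack converse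
  (`InversionPositiveLimitLevelwiseMack.posSemidef_inversionGram_of_covariantAt`) at arity `2` over the landed
  plane reflection positivity (`stub_osReflectionPositive ∘ stub_latticeRP`), `O(3)` invariance
  (`isRotationInvariant_of_scaleCovariantLimit`) and permutation symmetry (`isPermutationSymmetric_of_limit`) of
  such limits;
* `⇒` (`levelFour_of_fourPointConeMembership`): inversion covariance of `S₄` is read off the SYMMETRY of the
  `2 × 2` Gram matrices at sphere-separated 2|2 configurations (`levelFour_of_split`) and propagated to all
  configurations by permutation symmetry (`levelFour_of_perm`, sorting by norms), scale covariance
  (`levelFour_smul`, `levelFour_of_sorted`) and the CONTINUITY of `S₄` off the diagonals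
  (`LimitMeshContinuity.continuousOn_limit`) along the norm-spreading deformation `xᵢ ↦ (1 + t i) xᵢ`,
  `t → 0⁺` — no real-analyticity is needed (the route text lists this propagation as "not decomposed yet").

So the rank-3 crux of the route is precisely the level-4 instance of item stmt-1982 (Polyakov's inversion
upgrade) — `fourPointConeMembership_of_inversionUpgradeNormalised` — i.e. of the residual of crux stmt-4671.
No `sorry`, no definitions.
-/

noncomputable section

open EuclideanGeometry Filter Topology Finset
open Literature.Probability.LatticeModels Literature.MathematicalPhysics.QuantumFieldTheory

namespace Summit.CriticalPhenomena.Ising3DConformalLimit.InversionPositiveLimitLevelFour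

open Summit.CriticalPhenomena.Ising3DConformalLimit.MoebiusLimitExistsMackConverse (unitInversion_eq)
open Summit.CriticalPhenomena.Ising3DConformalLimit.InversionPositiveLimitLevelwiseMack
  (posSemidef_inversionGram_of_covariantAt)
open Summit.CriticalPhenomena.Ising3DConformalLimit.PositivityBegetsConformalityInversionPositiveLimit
  (injective_of_apply_zero_ne_one)
open Summit.CriticalPhenomena.Ising3DConformalLimit.Cruxes.InversionUpgradeNormalised.FreeEndpointGaussianClosure
  (stub_osReflectionPositive stub_latticeRP isPermutationSymmetric_of_limit)
open Summit.CriticalPhenomena.Ising3DConformalLimit.MoebiusLimitExistsTwoLeaf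
  (isRotationInvariant_of_scaleCovariantLimit)

variable {d : ℕ}

/-! Throughout, "inversion covariance of `S` at level 4" is the statement
`∀ x : Fin 4 → ℝ^d, (∀ i, x i ≠ 0) → S 4 (ι x) = (∏ i, ‖x i‖ ^ (2 * Δ)) * S 4 x`, written out. -/

/-- `‖ι y‖ = ‖y‖⁻¹` for the unit inversion. [folklore] -/
theorem norm_unitInversion (y : EuclideanSpace ℝ (Fin d)) :
    ‖inversion (0 : EuclideanSpace ℝ (Fin d)) 1 y‖ = ‖y‖⁻¹ := by
  have h := dist_inversion_center (0 : EuclideanSpace ℝ (Fin d)) y 1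
  rwa [dist_zero_right, dist_zero_right, one_pow, one_div] at h

/-- The unit inversion anti-commutes with dilations: `ι (c • y) = c⁻¹ • ι y`. [folklore] -/
theorem unitInversion_smul (c : ℝ) (y : EuclideanSpace ℝ (Fin d)) :
    inversion (0 : EuclideanSpace ℝ (Fin d)) 1 (c • y) = c⁻¹ • inversion (0 : EuclideanSpace ℝ (Fin d)) 1 y := by
  rw [unitInversion_eq, unitInversion_eq, smul_smul, smul_smul]
  by_cases hc : c = 0
  · simp [hc]
  by_cases hy : y = 0
  · simp [hy]
  congr 1
  have hn : ‖y‖ ≠ 0 := norm_ne_zero_iff.2 hy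
  rw [norm_smul, Real.norm_eq_abs, mul_pow, sq_abs]
  field_simp

/-- `(‖y‖⁻¹)^(-s) = ‖y‖^s`: the weight of an inverted point. [folklore] -/
theorem norm_unitInversion_rpow_neg (y : EuclideanSpace ℝ (Fin d)) (s : ℝ) :
    ‖inversion (0 : EuclideanSpace ℝ (Fin d)) 1 y‖ ^ (-s) = ‖y‖ ^ s := by
  rw [norm_unitInversion, Real.inv_rpow (norm_nonneg _), Real.rpow_neg (norm_nonneg _), inv_inv]

/-- **Level-4 inversion covariance is dilation invariant**: if it holds at `y` it holds at `c • y`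
(`c > 0`), by scale covariance. [folklore] -/
theorem levelFour_smul {Δ : ℝ} {S : CorrFamily d} (hsc : IsScaleCovariant Δ S) {c : ℝ} (hc : 0 < c)
    {y : Fin 4 → EuclideanSpace ℝ (Fin d)}
    (h : S 4 (fun i => inversion 0 1 (y i)) = (∏ i, ‖y i‖ ^ (2 * Δ)) * S 4 y) :
    S 4 (fun i => inversion 0 1 (c • y i)) = (∏ i, ‖c • y i‖ ^ (2 * Δ)) * S 4 (fun i => c • y i) := by
  have e0 : (fun i => inversion (0 : EuclideanSpace ℝ (Fin d)) 1 (c • y i)) =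
      fun i => c⁻¹ • inversion (0 : EuclideanSpace ℝ (Fin d)) 1 (y i) :=
    funext fun i => unitInversion_smul c (y i)
  have h1 := hsc 4 c⁻¹ (inv_pos.2 hc) (fun i => inversion 0 1 (y i))
  have h2 := hsc 4 c hc y
  have e1 : (c⁻¹ : ℝ) ^ (-((4 : ℕ) : ℝ) * Δ) = c ^ (4 * Δ) := by
    rw [Real.inv_rpow hc.le, ← Real.rpow_neg hc.le]
    norm_num
  have e2 : (∏ i, ‖c • y i‖ ^ (2 * Δ)) = c ^ (8 * Δ) * ∏ i, ‖y i‖ ^ (2 * Δ) := by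
    have : ∀ i, ‖c • y i‖ ^ (2 * Δ) = c ^ (2 * Δ) * ‖y i‖ ^ (2 * Δ) := fun i => by
      rw [norm_smul, Real.norm_eq_abs, abs_of_pos hc, Real.mul_rpow hc.le (norm_nonneg _)]
    rw [Finset.prod_congr rfl fun i _ => this i, Finset.prod_mul_distrib, Finset.prod_const,
      Finset.card_univ, Fintype.card_fin, ← Real.rpow_mul_natCast hc.le]
    congr 2
    push_cast
    ring
  have e3 : c ^ (8 * Δ) * c ^ (-((4 : ℕ) : ℝ) * Δ) = c ^ (4 * Δ) := by
    rw [← Real.rpow_add hc]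
    norm_num
    ring_nf
  rw [e0, h1, h2, h, e1, e2]
  calc c ^ (4 * Δ) * ((∏ i, ‖y i‖ ^ (2 * Δ)) * S 4 y)
      = (c ^ (8 * Δ) * c ^ (-((4 : ℕ) : ℝ) * Δ)) * ((∏ i, ‖y i‖ ^ (2 * Δ)) * S 4 y) := by rw [e3]
    _ = c ^ (8 * Δ) * (∏ i, ‖y i‖ ^ (2 * Δ)) * (c ^ (-((4 : ℕ) : ℝ) * Δ) * S 4 y) := by ring

/-- **Level-4 inversion covariance is permutation invariant**: if it holds at `x ∘ σ` it holds at `x`.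
[folklore] -/
theorem levelFour_of_perm {Δ : ℝ} {S : CorrFamily d} (hperm : IsPermutationSymmetric S)
    (σ : Equiv.Perm (Fin 4)) {x : Fin 4 → EuclideanSpace ℝ (Fin d)}
    (h : S 4 (fun i => inversion 0 1 (x (σ i))) = (∏ i, ‖x (σ i)‖ ^ (2 * Δ)) * S 4 (fun i => x (σ i))) :
    S 4 (fun i => inversion 0 1 (x i)) = (∏ i, ‖x i‖ ^ (2 * Δ)) * S 4 x := by
  have e1 : S 4 (fun i => inversion 0 1 (x (σ i))) = S 4 (fun i => inversion 0 1 (x i)) :=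
    hperm 4 σ (fun i => inversion 0 1 (x i))
  have e2 : S 4 (fun i => x (σ i)) = S 4 x := hperm 4 σ x
  have e3 : (∏ i, ‖x (σ i)‖ ^ (2 * Δ)) = ∏ i, ‖x i‖ ^ (2 * Δ) :=
    Equiv.prod_comp σ (fun i => ‖x i‖ ^ (2 * Δ))
  rw [e1, e2, e3] at h
  exact h

/-- **The 2 × 2 symmetry step.** If the 2|2 radial OS Gram matrices of `S₄` are positive semidefinite
(the matrix family of `FourPointConeMembership`, for this `S` and `Δ`) and `S` is permutation symmetric, then
`S₄` is inversion covariant at every SPHERE-SEPARATED configuration `v` (two points inside, two outside the unit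
sphere): symmetry of the Gram matrix of the pair `X₀ = (v₀, v₁)`, `X₁ = (ιv₂, ιv₃)`. [folklore] -/
theorem levelFour_of_split {Δ : ℝ} {S : CorrFamily d} (hperm : IsPermutationSymmetric S)
    (hP : ∀ (m : ℕ) (X : Fin m → Fin 2 → EuclideanSpace ℝ (Fin d)), (∀ a i, X a i ≠ 0 ∧ ‖X a i‖ < 1) →
      (∀ a, X a 0 ≠ X a 1) →
      (Matrix.of fun a b : Fin m => (∏ i, ‖X b i‖ ^ (-(2 * Δ))) *
        S 4 (Fin.append (X a) (fun i => inversion 0 1 (X b i)))).PosSemidef)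
    {v : Fin 4 → EuclideanSpace ℝ (Fin d)} (hinj : Function.Injective v) (h0 : ∀ i, v i ≠ 0)
    (hv0 : ‖v 0‖ < 1) (hv1 : ‖v 1‖ < 1) (hv2 : 1 < ‖v 2‖) (hv3 : 1 < ‖v 3‖) :
    S 4 (fun i => inversion 0 1 (v i)) = (∏ i, ‖v i‖ ^ (2 * Δ)) * S 4 v := by
  have hι0 : ∀ i, inversion (0 : EuclideanSpace ℝ (Fin d)) 1 (v i) ≠ 0 := fun i h => by
    have := congrArg norm h
    rw [norm_unitInversion, norm_zero, inv_eq_zero, norm_eq_zero] at this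
    exact h0 i this
  have hιlt : ∀ i, 1 < ‖v i‖ → ‖inversion (0 : EuclideanSpace ℝ (Fin d)) 1 (v i)‖ < 1 := fun i hi => by
    rw [norm_unitInversion]
    exact inv_lt_one_of_one_lt₀ hi
  have hM := hP 2 ![![v 0, v 1], ![inversion 0 1 (v 2), inversion 0 1 (v 3)]] ?_ ?_
  rotate_left
  · intro a i
    fin_cases a <;> fin_cases i
    · exact ⟨h0 0, hv0⟩
    · exact ⟨h0 1, hv1⟩
    · exact ⟨hι0 2, hιlt 2 hv2⟩
    · exact ⟨hι0 3, hιlt 3 hv3⟩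
  · intro a
    fin_cases a
    · exact hinj.ne (by decide)
    · exact (inversion_injective (0 : EuclideanSpace ℝ (Fin d)) one_ne_zero).ne (hinj.ne (by decide))
  have e := hM.1.apply 0 1
  simp only [star_trivial, Matrix.of_apply, Fin.prod_univ_two, Matrix.cons_val_zero, Matrix.cons_val_one] at e
  -- the two configurations
  have c1 : Fin.append (![v 0, v 1] : Fin 2 → EuclideanSpace ℝ (Fin d))
      (fun i => inversion 0 1 ((![inversion 0 1 (v 2), inversion 0 1 (v 3)] : Fin 2 → EuclideanSpace ℝ (Fin d)) i)) = v := by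
    funext i
    refine Fin.addCases (fun j => ?_) (fun j => ?_) i
    · rw [Fin.append_left]
      fin_cases j <;> rfl
    · rw [Fin.append_right]
      fin_cases j <;> simp [inversion_inversion _ one_ne_zero]
  have c2 : S 4 (Fin.append (![inversion 0 1 (v 2), inversion 0 1 (v 3)] : Fin 2 → EuclideanSpace ℝ (Fin d))
      (fun i => inversion 0 1 ((![v 0, v 1] : Fin 2 → EuclideanSpace ℝ (Fin d)) i))) =
      S 4 (fun i => inversion 0 1 (v i)) := by
    rw [← hperm.comp_equiv (finBlockSwap 2 2), fin_append_comp_finBlockSwap]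
    congr 1
    funext i
    refine Fin.addCases (fun j => ?_) (fun j => ?_) i
    · rw [Fin.append_left]
      fin_cases j <;> rfl
    · rw [Fin.append_right]
      fin_cases j <;> rfl
  rw [c1, c2, norm_unitInversion_rpow_neg, norm_unitInversion_rpow_neg] at e
  -- `e : ‖v 0‖^(-2Δ) ‖v 1‖^(-2Δ) S₄(ιv) = ‖v 2‖^(2Δ) ‖v 3‖^(2Δ) S₄(v)` (up to the order of the two sides)
  have hp : ∀ i, 0 < ‖v i‖ ^ (2 * Δ) := fun i => Real.rpow_pos_of_pos (norm_pos_iff.2 (h0 i)) _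
  have hn : ∀ i, ‖v i‖ ^ (-(2 * Δ)) = (‖v i‖ ^ (2 * Δ))⁻¹ := fun i => Real.rpow_neg (norm_nonneg _) _
  rw [hn, hn] at e
  rw [Fin.prod_univ_four]
  have h0' := (hp 0).ne'
  have h1' := (hp 1).ne'
  field_simp at e
  linear_combination e


/-- **Sorted configurations.** If the 2|2 Gram matrices are positive semidefinite, `S` is permutation symmetric
and scale covariant, then `S₄` is inversion covariant at every configuration with STRICTLY increasing norms
`0 < ‖u₀‖ < ‖u₁‖ < ‖u₂‖ < ‖u₃‖`: rescale by the radius `R = (‖u₁‖ + ‖u₂‖)/2` of a separating sphere and apply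
`levelFour_of_split`, then undo the rescaling (`levelFour_smul`). [folklore] -/
theorem levelFour_of_sorted {Δ : ℝ} {S : CorrFamily d} (hsc : IsScaleCovariant Δ S)
    (hperm : IsPermutationSymmetric S)
    (hP : ∀ (m : ℕ) (X : Fin m → Fin 2 → EuclideanSpace ℝ (Fin d)), (∀ a i, X a i ≠ 0 ∧ ‖X a i‖ < 1) →
      (∀ a, X a 0 ≠ X a 1) →
      (Matrix.of fun a b : Fin m => (∏ i, ‖X b i‖ ^ (-(2 * Δ))) *
        S 4 (Fin.append (X a) (fun i => inversion 0 1 (X b i)))).PosSemidef)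
    {u : Fin 4 → EuclideanSpace ℝ (Fin d)} (hu0 : 0 < ‖u 0‖) (h01 : ‖u 0‖ < ‖u 1‖)
    (h12 : ‖u 1‖ < ‖u 2‖) (h23 : ‖u 2‖ < ‖u 3‖) :
    S 4 (fun i => inversion 0 1 (u i)) = (∏ i, ‖u i‖ ^ (2 * Δ)) * S 4 u := by
  have hmono : StrictMono (fun i : Fin 4 => ‖u i‖) := by
    refine Fin.strictMono_iff_lt_succ.2 fun i => ?_
    fin_cases i
    · exact h01
    · exact h12
    · exact h23
  have hinj : Function.Injective u := fun i j hij => hmono.injective (congrArg norm hij : ‖u i‖ = ‖u j‖)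
  have hne : ∀ i, u i ≠ 0 := fun i h => by
    have hi : ‖u 0‖ ≤ ‖u i‖ := hmono.monotone (Fin.zero_le i)
    rw [h, norm_zero] at hi
    exact absurd hi (not_le.2 hu0)
  set R : ℝ := (‖u 1‖ + ‖u 2‖) / 2 with hR
  have hRpos : 0 < R := by
    have : 0 < ‖u 1‖ := hu0.trans h01
    positivity
  have h1R : ‖u 1‖ < R := by rw [hR]; linarith
  have hR2 : R < ‖u 2‖ := by rw [hR]; linarith
  have hRinv : 0 < R⁻¹ := inv_pos.2 hRpos
  have hnorm : ∀ i, ‖R⁻¹ • u i‖ = R⁻¹ * ‖u i‖ := fun i => by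
    rw [norm_smul, Real.norm_eq_abs, abs_of_pos hRinv]
  have hlt : ∀ i, ‖u i‖ < R → ‖R⁻¹ • u i‖ < 1 := fun i hi => by
    rw [hnorm, inv_mul_lt_iff₀ hRpos]
    simpa using hi
  have hgt : ∀ i, R < ‖u i‖ → 1 < ‖R⁻¹ • u i‖ := fun i hi => by
    rw [hnorm, lt_inv_mul_iff₀ hRpos]
    simpa using hi
  have key := levelFour_of_split hperm hP (v := fun i => R⁻¹ • u i)
    ((smul_right_injective (EuclideanSpace ℝ (Fin d)) hRinv.ne').comp hinj)
    (fun i => smul_ne_zero hRinv.ne' (hne i))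
    (hlt 0 (h01.trans h1R)) (hlt 1 h1R) (hgt 2 hR2) (hgt 3 (hR2.trans h23))
  have back := levelFour_smul hsc hRpos key
  simpa only [smul_smul, mul_inv_cancel₀ hRpos.ne', one_smul] using back

/-- **`FourPointConeMembership` ⇒ the four-point function of every admissible limit is inversion covariant.**
For a normalised, non-degenerate, translation-invariant, scale-covariant pointwise limit `S` of `criticalCorr 3`
whose 2|2 radial OS Gram matrices are positive semidefinite (item stmt-4672 for this `S`),
`S₄(ιx) = ∏ᵢ ‖xᵢ‖^{2Δ} S₄(x)` for EVERY `x` avoiding the origin: non-injective `x` — both sides vanish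
(normalisation; `ι` is injective); injective `x` — sort by norms (`Tuple.sort`, permutation symmetry
`isPermutationSymmetric_of_limit`), spread the norms strictly by `xᵢ ↦ (1 + t i) xᵢ`, `t > 0`
(`levelFour_of_sorted`), and let `t → 0⁺` using the continuity of `S₄` off the diagonals
(`LimitMeshContinuity.continuousOn_limit`). [folklore] -/
theorem levelFour_of_fourPointConeMembership
    (h : Summit.CriticalPhenomena.Ising3DConformalLimit.Theses.PositivityBegetsConformality.FourPointConeMembership) :
    ∀ (ρ : ℝ → ℝ) (Δ : ℝ) (S : CorrFamily 3), (∀ δ ∈ Set.Ioc (0:ℝ) 1, 0 < ρ δ) →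
      HasPointwiseScalingLimit (criticalCorr 3) ρ S → (∀ n z, z ∉ NonCoincident 3 n → S n z = 0) →
      IsNondegenerateTwoPoint S → IsTranslationInvariant S → IsScaleCovariant Δ S →
      ∀ x : Fin 4 → EuclideanSpace ℝ (Fin 3), (∀ i, x i ≠ 0) →
        S 4 (fun i => inversion 0 1 (x i)) = (∏ i, ‖x i‖ ^ (2 * Δ)) * S 4 x := by
  intro ρ Δ S hρ hlim hnorm hnd htr hsc x hx0
  have hperm : IsPermutationSymmetric S := isPermutationSymmetric_of_limit hlim hnorm
  have hP := h ρ Δ S hρ hlim hnorm hnd htr hsc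
  by_cases hinj : Function.Injective x
  swap
  · have h1 : S 4 x = 0 := hnorm 4 x hinj
    have h2 : S 4 (fun i => inversion 0 1 (x i)) = 0 :=
      hnorm 4 _ fun hι => hinj (Function.Injective.of_comp (f := inversion (0 : EuclideanSpace ℝ (Fin 3)) 1) hι)
    rw [h1, h2, mul_zero]
  -- sort by norms
  set σ : Equiv.Perm (Fin 4) := Tuple.sort (fun i => ‖x i‖) with hσ
  have hmono : Monotone (fun i => ‖x (σ i)‖) := Tuple.monotone_sort (fun i => ‖x i‖)
  refine levelFour_of_perm hperm σ ?_
  set z : Fin 4 → EuclideanSpace ℝ (Fin 3) := fun i => x (σ i) with hz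
  have hz0 : ∀ i, z i ≠ 0 := fun i => hx0 _
  have hzinj : Function.Injective z := hinj.comp σ.injective
  have hzpos : ∀ i, 0 < ‖z i‖ := fun i => norm_pos_iff.2 (hz0 i)
  -- the perturbation `y t i = (1 + t i) • z i`
  have hcoef : ∀ (t : ℝ), 0 < t → ∀ i : Fin 4, 0 < 1 + t * (i : ℝ) := fun t ht i => by positivity
  have hny : ∀ (t : ℝ), 0 < t → ∀ i : Fin 4, ‖(1 + t * (i : ℝ)) • z i‖ = (1 + t * (i : ℝ)) * ‖z i‖ :=
    fun t ht i => by rw [norm_smul, Real.norm_eq_abs, abs_of_pos (hcoef t ht i)]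
  have hlt : ∀ (t : ℝ), 0 < t → ∀ i j : Fin 4, i < j →
      ‖(1 + t * (i : ℝ)) • z i‖ < ‖(1 + t * (j : ℝ)) • z j‖ := by
    intro t ht i j hij
    rw [hny t ht i, hny t ht j]
    have hzij : ‖z i‖ ≤ ‖z j‖ := hmono hij.le
    have hij' : (i : ℝ) < (j : ℝ) := by exact_mod_cast hij
    calc (1 + t * (i : ℝ)) * ‖z i‖ ≤ (1 + t * (i : ℝ)) * ‖z j‖ :=
          mul_le_mul_of_nonneg_left hzij (hcoef t ht i).le
      _ < (1 + t * (j : ℝ)) * ‖z j‖ := by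
          apply mul_lt_mul_of_pos_right _ (hzpos j)
          nlinarith
  have hy : ∀ t : ℝ, 0 < t →
      S 4 (fun i : Fin 4 => inversion 0 1 ((1 + t * (i : ℝ)) • z i)) =
        (∏ i : Fin 4, ‖(1 + t * (i : ℝ)) • z i‖ ^ (2 * Δ)) * S 4 (fun i : Fin 4 => (1 + t * (i : ℝ)) • z i) := by
    intro t ht
    refine levelFour_of_sorted hsc hperm hP ?_ (hlt t ht 0 1 (by decide)) (hlt t ht 1 2 (by decide))
      (hlt t ht 2 3 (by decide))
    rw [hny t ht 0]
    exact mul_pos (hcoef t ht 0) (hzpos 0)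
  -- limits as `t → 0⁺`
  have hcfg : Tendsto (fun t : ℝ => fun i : Fin 4 => (1 + t * (i : ℝ)) • z i) (𝓝[>] 0) (𝓝 z) := by
    refine tendsto_pi_nhds.2 fun i => ?_
    have h1 : Tendsto (fun t : ℝ => 1 + t * (i : ℝ)) (𝓝[>] 0) (𝓝 1) := by
      have : Tendsto (fun t : ℝ => (1 : ℝ) + t * (i : ℝ)) (𝓝 0) (𝓝 (1 + 0 * (i : ℝ))) :=
        tendsto_const_nhds.add (tendsto_id.mul tendsto_const_nhds)
      rw [zero_mul, add_zero] at this
      exact this.mono_left nhdsWithin_le_nhds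
    simpa using h1.smul (tendsto_const_nhds : Tendsto (fun _ : ℝ => z i) (𝓝[>] 0) (𝓝 (z i)))
  have hcfgι : Tendsto (fun t : ℝ => fun i : Fin 4 => inversion 0 1 ((1 + t * (i : ℝ)) • z i)) (𝓝[>] 0)
      (𝓝 (fun i => inversion 0 1 (z i))) := by
    refine tendsto_pi_nhds.2 fun i => ?_
    have h1 : Tendsto (fun t : ℝ => (1 + t * (i : ℝ))⁻¹) (𝓝[>] 0) (𝓝 1) := by
      have : Tendsto (fun t : ℝ => (1 : ℝ) + t * (i : ℝ)) (𝓝 0) (𝓝 (1 + 0 * (i : ℝ))) :=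
        tendsto_const_nhds.add (tendsto_id.mul tendsto_const_nhds)
      rw [zero_mul, add_zero] at this
      simpa using (this.mono_left nhdsWithin_le_nhds).inv₀ one_ne_zero
    have h2 := h1.smul (tendsto_const_nhds :
      Tendsto (fun _ : ℝ => inversion (0 : EuclideanSpace ℝ (Fin 3)) 1 (z i)) (𝓝[>] 0) (𝓝 (inversion 0 1 (z i))))
    simp only [one_smul] at h2
    refine h2.congr fun t => ?_
    exact (unitInversion_smul _ _).symm
  have hzmem : z ∈ NonCoincident 3 4 := hzinj
  have hιzmem : (fun i => inversion 0 1 (z i)) ∈ NonCoincident 3 4 :=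
    (inversion_injective (0 : EuclideanSpace ℝ (Fin 3)) one_ne_zero).comp hzinj
  have hcont : ∀ w ∈ NonCoincident 3 4, ContinuousAt (S 4) w := fun w hw =>
    (LimitMeshContinuity.continuousOn_limit hlim 4).continuousAt ((isOpen_nonCoincident 3 4).mem_nhds hw)
  have lim1 : Tendsto (fun t : ℝ => S 4 (fun i : Fin 4 => inversion 0 1 ((1 + t * (i : ℝ)) • z i))) (𝓝[>] 0)
      (𝓝 (S 4 (fun i => inversion 0 1 (z i)))) :=
    (hcont _ hιzmem).tendsto.comp hcfgι
  have lim2 : Tendsto (fun t : ℝ => (∏ i : Fin 4, ‖(1 + t * (i : ℝ)) • z i‖ ^ (2 * Δ)) *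
      S 4 (fun i : Fin 4 => (1 + t * (i : ℝ)) • z i)) (𝓝[>] 0) (𝓝 ((∏ i, ‖z i‖ ^ (2 * Δ)) * S 4 z)) := by
    refine Tendsto.mul (tendsto_finsetProd _ fun i _ => ?_) ((hcont _ hzmem).tendsto.comp hcfg)
    have hi : Tendsto (fun t : ℝ => (1 + t * (i : ℝ)) • z i) (𝓝[>] 0) (𝓝 (z i)) :=
      (tendsto_pi_nhds.1 hcfg) i
    exact ((continuous_norm.tendsto _).comp hi).rpow_const (Or.inl (norm_ne_zero_iff.2 (hz0 i)))
  exact tendsto_nhds_unique_of_eventuallyEq lim1 lim2 (eventually_nhdsWithin_of_forall fun t ht => hy t ht)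

/-- **Inversion covariance of `S₄` ⇒ `FourPointConeMembership`** (the levelwise Mack converse at arity 2 for
admissible limits): plane reflection positivity along an axis (`stub_osReflectionPositive ∘ stub_latticeRP`),
`O(3)` invariance (`isRotationInvariant_of_scaleCovariantLimit`, hence reflection invariance) and permutation
symmetry (`isPermutationSymmetric_of_limit`) are theorems for such limits, and the 2|2 Gram matrix involves `S`
at level `4` only (`posSemidef_inversionGram_of_covariantAt`). [cite: LuscherMack1975, §2–§3] -/
theorem fourPointConeMembership_of_levelFour
    (h : ∀ (ρ : ℝ → ℝ) (Δ : ℝ) (S : CorrFamily 3), (∀ δ ∈ Set.Ioc (0:ℝ) 1, 0 < ρ δ) →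
      HasPointwiseScalingLimit (criticalCorr 3) ρ S → (∀ n z, z ∉ NonCoincident 3 n → S n z = 0) →
      IsNondegenerateTwoPoint S → IsTranslationInvariant S → IsScaleCovariant Δ S →
      ∀ x : Fin 4 → EuclideanSpace ℝ (Fin 3), (∀ i, x i ≠ 0) →
        S 4 (fun i => inversion 0 1 (x i)) = (∏ i, ‖x i‖ ^ (2 * Δ)) * S 4 x) :
    Summit.CriticalPhenomena.Ising3DConformalLimit.Theses.PositivityBegetsConformality.FourPointConeMembership := by
  intro ρ Δ S hρ hlim hnorm hnd htr hsc m X hX hne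
  have hperm : IsPermutationSymmetric S := isPermutationSymmetric_of_limit hlim hnorm
  have hrot : IsRotationInvariant S := isRotationInvariant_of_scaleCovariantLimit hρ hlim hnorm hnd htr hsc
  have hrp : IsReflectionPositiveAlong (0 : Fin 3) S := stub_osReflectionPositive stub_latticeRP ρ S hρ hlim htr 0
  have hR : IsReflectionInvariantAlong (0 : Fin 3) S := fun n x => hrot n (axisReflection 0) x
  have h4 := h ρ Δ S hρ hlim hnorm hnd htr hsc
  exact posSemidef_inversionGram_of_covariantAt 0 htr hsc hperm hR hrp (k := fun _ => 2) hX
    (fun a => injective_of_apply_zero_ne_one (hne a)) (fun _ _ => h4)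

/-- **Item stmt-4672 `FourPointConeMembership` is EXACTLY the four-point level of the inversion upgrade.**
The 2|2 radial OS Gram matrices of every admissible limit of the critical `ℤ³` Ising correlators are positive
semidefinite if and only if the four-point function of every admissible limit is inversion covariant,
`S₄(ιx) = ∏ᵢ ‖xᵢ‖^{2Δ} S₄(x)` off the origin (`levelFour_of_fourPointConeMembership`,
`fourPointConeMembership_of_levelFour`): the positivity half of the rank-3 crux is implied by its symmetry
half, and the symmetry half propagates from sphere-separated to all configurations by continuity alone.
[cite: LuscherMack1975, §2–§3] -/
theorem fourPointConeMembership_iff_levelFour : Summit.CriticalPhenomena.Ising3DConformalLimit.Theses.PositivityBegetsConformality.FourPointConeMembership ↔ ∀ (ρ : ℝ → ℝ) (Δ : ℝ) (S : Literature.Probability.LatticeModels.CorrFamily 3), (∀ δ ∈ Set.Ioc (0:ℝ) 1, 0 < ρ δ) → Literature.Probability.LatticeModels.HasPointwiseScalingLimit (Literature.Probability.LatticeModels.criticalCorr 3) ρ S → (∀ n z, z ∉ Literature.Probability.LatticeModels.NonCoincident 3 n → S n z = 0) → Literature.Probability.LatticeModels.IsNondegenerateTwoPoint S → Literature.Probability.LatticeModels.IsTranslationInvariant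 S → Literature.Probability.LatticeModels.IsScaleCovariant Δ S → ∀ x : Fin 4 → EuclideanSpace ℝ (Fin 3), (∀ i, x i ≠ 0) → S 4 (fun i => EuclideanGeometry.inversion 0 1 (x i)) = (∏ i, ‖x i‖ ^ (2 * Δ)) * S 4 x :=
  ⟨levelFour_of_fourPointConeMembership, fourPointConeMembership_of_levelFour⟩

/-- **Consequently item stmt-1982 (the full inversion upgrade) implies item stmt-4672** directly at level 4 —
a second route edge next to `4671 ⇒ 4672` (`fourPointConeMembership_of_inversionPositiveLimit`): the isotropy
needed to feed `InversionUpgradeNormalised` is `isRotationInvariant_of_scaleCovariantLimit`. [folklore] -/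
theorem fourPointConeMembership_of_inversionUpgradeNormalised
    (h1982 : Summit.CriticalPhenomena.Ising3DConformalLimit.Theses.HyperoctahedralRP.InversionUpgradeNormalised) :
    Summit.CriticalPhenomena.Ising3DConformalLimit.Theses.PositivityBegetsConformality.FourPointConeMembership :=
  fourPointConeMembership_of_levelFour fun ρ Δ S hρ hlim hnorm hnd htr hsc x hx =>
    h1982 ρ Δ S hρ hlim hnorm hnd ⟨htr, isRotationInvariant_of_scaleCovariantLimit hρ hlim hnorm hnd htr hsc⟩
      hsc 4 x hx

end Summit.CriticalPhenomena.Ising3DConformalLimit.InversionPositiveLimitLevelFour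

end
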